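import Summits.ValiantsHypothesis.ValiantsHypothesis.Theorems.SymPencilPerFourInnerRankIsotropicCone

/-!
# Route `SymPencil` — inner rank of the `2 | 2` row split of `per_4`: linear subspaces of
# dimension `≥ 4` of the common isotropic cone are one-sided (`--supports`
# stmt-ValiantsHypothesis-5674 `SdcSuperquadratic`; (8,8) column, isotropic-kernel route)

**Theorem** (`fst_or_snd_of_four_le`, `fst_or_snd_of_four_le_diag`).  If `W ≤ K⁴ × K⁴` has
dimension `≥ 4` and lies in the common isotropic cone `{per (v; e_l; y₂; y₃) = 0 ∀ l}` (`v = 𝟙`,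
resp. `v` with non-zero coordinates), then `W ≤ K⁴ ⊕ 0` or `W ≤ 0 ⊕ K⁴`.

Proof.  By `SymPencilPerFourInnerRankIsotropicCone.cone_dichotomies`, for each of the five indices
`j` (four coordinates and the coordinate sum) one of the two functionals `p_j`, `q_j` vanishes on
`W`.  If both sides occur, the map `w ↦ (p_j(w) or q_j(w))_j ∈ K⁵` is injective on `W` and lands in
the intersection of the two independent hyperplanes `Σ_{p-side} κ_j z_j = 0`, `Σ_{q-side} κ_j z_j = 0`
(`κ = (1,1,1,1,2)`, from `Σ_l p_l + 2 p₄ = 0`), which has dimension `3 < 4`.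

Role: the "mixed type II" kill and the `4`-dimensional case of the slot analysis (memo
`NOTE-p6g15-5674-IR12-reduction.md` §2).  Honest framing: elementary lemma in a conditional
reduction of the cells `(8,8,10)`, `(8,8,11)`; the window `27 ≤ sdc(per_4) ≤ 29`, the crux and
`VP ≠ VNP` are untouched.  No definitions, no named facts. [folklore]
-/

noncomputable section

-- single-conjunct layout: Sub = Summit, duplicated namespace component intended
set_option linter.dupNamespace false

namespace Summit.ValiantsHypothesis.ValiantsHypothesis.Theorems.SymPencilPerFourInnerRankConeFour

open Matrix Finset Module
open Summit.ValiantsHypothesis.ValiantsHypothesis.Theorems.SymPencilPerFourInnerRankRows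
open Summit.ValiantsHypothesis.ValiantsHypothesis.Theorems.SymPencilPerFourInnerRankIsotropicCone

variable {K : Type*} [Field K]

/-- **`≥ 4`-dimensional linear subspaces of the cone at `𝟙` are one-sided.** [folklore] -/
theorem fst_or_snd_of_four_le [CharZero K] (W : Submodule K ((Fin 4 → K) × (Fin 4 → K)))
    (hW : ∀ w ∈ W, ∀ l : Fin 4,
      (Matrix.of ![(fun _ => (1 : K)), Pi.single l 1, w.1, w.2]).permanent = 0)
    (h4 : 4 ≤ finrank K W) :
    (∀ w ∈ W, w.2 = 0) ∨ (∀ w ∈ W, w.1 = 0) := by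
  classical
  obtain ⟨hA, hB⟩ := cone_dichotomies W hW (le_trans (by norm_num) h4)
  -- the five functionals on each side, indexed by `Option (Fin 4)` (`none` = coordinate sum)
  let s₁ : ((Fin 4 → K) × (Fin 4 → K)) → K := fun w => w.1 0 + w.1 1 + w.1 2 + w.1 3
  let s₂ : ((Fin 4 → K) × (Fin 4 → K)) → K := fun w => w.2 0 + w.2 1 + w.2 2 + w.2 3
  let Pt : Option (Fin 4) → ((Fin 4 → K) × (Fin 4 → K)) → K :=
    fun j w => j.elim (s₁ w) (fun l => 2 * w.1 l - s₁ w)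
  let Qt : Option (Fin 4) → ((Fin 4 → K) × (Fin 4 → K)) → K :=
    fun j w => j.elim (s₂ w) (fun l => 2 * w.2 l - s₂ w)
  let κ : Option (Fin 4) → K := fun j => j.elim 2 (fun _ => 1)
  have hκ : ∀ j, κ j ≠ 0 := fun j => by cases j <;> simp [κ]
  have Pt_add : ∀ j w w', Pt j (w + w') = Pt j w + Pt j w' := fun j w w' => by
    cases j <;> simp only [Pt, s₁, Option.elim, Prod.fst_add, Pi.add_apply] <;> ring
  have Qt_add : ∀ j w w', Qt j (w + w') = Qt j w + Qt j w' := fun j w w' => by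
    cases j <;> simp only [Qt, s₂, Option.elim, Prod.snd_add, Pi.add_apply] <;> ring
  have Pt_smul : ∀ j (c : K) w, Pt j (c • w) = c * Pt j w := fun j c w => by
    cases j <;> simp only [Pt, s₁, Option.elim, Prod.smul_fst, Pi.smul_apply, smul_eq_mul] <;> ring
  have Qt_smul : ∀ j (c : K) w, Qt j (c • w) = c * Qt j w := fun j c w => by
    cases j <;> simp only [Qt, s₂, Option.elim, Prod.smul_snd, Pi.smul_apply, smul_eq_mul] <;> ring
  -- the dichotomy for each of the five indices
  have hdich : ∀ j, (∀ w ∈ W, Pt j w = 0) ∨ (∀ w ∈ W, Qt j w = 0) := by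
    intro j
    cases j with
    | none => exact hA
    | some l =>
      rcases hB l with h | h
      · left; intro w hw; have := h w hw; simp only [Pt, s₁, Option.elim]; linear_combination this
      · right; intro w hw; have := h w hw; simp only [Qt, s₂, Option.elim]; linear_combination this
  -- the linear relation among the five functionals
  have relP : ∀ w, ∑ j, κ j * Pt j w = 0 := fun w => by
    simp only [κ, Pt, s₁, Fintype.sum_option, Option.elim, Fin.sum_univ_four]; ring
  have relQ : ∀ w, ∑ j, κ j * Qt j w = 0 := fun w => by
    simp only [κ, Qt, s₂, Fintype.sum_option, Option.elim, Fin.sum_univ_four]; ring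
  -- the side of each index: `P`-side iff `Pt j` does not vanish identically on `W`
  let sideP : Option (Fin 4) → Prop := fun j => ¬ ∀ w ∈ W, Pt j w = 0
  have hQ_of_P : ∀ j, sideP j → ∀ w ∈ W, Qt j w = 0 := fun j hj => (hdich j).resolve_left hj
  have hP_of_notP : ∀ j, ¬ sideP j → ∀ w ∈ W, Pt j w = 0 := fun j hj => by
    simp only [sideP, not_not] at hj; exact hj
  by_contra hcon
  push Not at hcon
  obtain ⟨⟨w₁, hw₁, hw₁ne⟩, ⟨w₂, hw₂, hw₂ne⟩⟩ := hcon
  -- both sides occur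
  have exP : ∃ jP, sideP jP := by
    by_contra h
    push Not at h
    apply hw₂ne
    have h0 : ∀ j, Pt j w₂ = 0 := fun j => h j w₂ hw₂
    have hs : s₁ w₂ = 0 := h0 none
    funext l
    have hl := h0 (some l)
    simp only [Pt, Option.elim] at hl hs
    rw [hs, sub_zero] at hl
    simpa using hl
  have exQ : ∃ jQ, ¬ sideP jQ := by
    by_contra h
    push Not at h
    apply hw₁ne
    have h0 : ∀ j, Qt j w₁ = 0 := fun j =>
      hQ_of_P j (fun hall => by obtain ⟨w, hw, hne⟩ := h j; exact hne (hall w hw)) w₁ hw₁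
    have hs : s₂ w₁ = 0 := h0 none
    funext l
    have hl := h0 (some l)
    simp only [Qt, Option.elim] at hl hs
    rw [hs, sub_zero] at hl
    simpa using hl
  obtain ⟨jP, hjP⟩ := exP
  obtain ⟨jQ, hjQ⟩ := exQ
  -- the merged functionals `Ψ_j`
  let Ψ : Option (Fin 4) → ((Fin 4 → K) × (Fin 4 → K)) → K :=
    fun j w => if sideP j then Pt j w else Qt j w
  let Λ : W →ₗ[K] (Option (Fin 4) → K) :=
    { toFun := fun w j => Ψ j w
      map_add' := fun w w' => by
        funext j
        simp only [Ψ, Submodule.coe_add, Pi.add_apply]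
        split_ifs <;> simp [Pt_add, Qt_add]
      map_smul' := fun c w => by
        funext j
        simp only [Ψ, Submodule.coe_smul, Pi.smul_apply, smul_eq_mul, RingHom.id_apply]
        split_ifs <;> simp [Pt_smul, Qt_smul] }
  have hΛ : ∀ (w : W) j, Λ w j = Ψ j w := fun w j => rfl
  -- `Λ` is injective
  have hinj : Function.Injective Λ := by
    rw [← LinearMap.ker_eq_bot, LinearMap.ker_eq_bot']
    intro w hw
    have hΨ : ∀ j, Ψ j w = 0 := fun j => by rw [← hΛ]; exact congr_fun hw j
    have hPall : ∀ j, Pt j w = 0 := fun j => by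
      by_cases hj : sideP j
      · have := hΨ j; simp only [Ψ, if_pos hj] at this; exact this
      · exact hP_of_notP j hj w w.2
    have hQall : ∀ j, Qt j w = 0 := fun j => by
      by_cases hj : sideP j
      · exact hQ_of_P j hj w w.2
      · have := hΨ j; simp only [Ψ, if_neg hj] at this; exact this
    have hs1 : s₁ w = 0 := hPall none
    have hs2 : s₂ w = 0 := hQall none
    apply Subtype.ext
    refine Prod.ext (funext fun l => ?_) (funext fun l => ?_)
    · have hl := hPall (some l)
      simp only [Pt, Option.elim] at hl hs1
      rw [hs1, sub_zero] at hl
      simpa using hl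
    · have hl := hQall (some l)
      simp only [Qt, Option.elim] at hl hs2
      rw [hs2, sub_zero] at hl
      simpa using hl
  -- the two relations cut the image down to a `3`-space
  let Φ : (Option (Fin 4) → K) →ₗ[K] (K × K) :=
    { toFun := fun z => (∑ j, if sideP j then κ j * z j else 0, ∑ j, if sideP j then 0 else κ j * z j)
      map_add' := fun z z' => by
        refine Prod.ext ?_ ?_
        · show (∑ j, if sideP j then κ j * (z + z') j else 0) =
              (∑ j, if sideP j then κ j * z j else 0) + ∑ j, if sideP j then κ j * z' j else 0
          rw [← Finset.sum_add_distrib]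
          exact Finset.sum_congr rfl fun j _ => by rw [Pi.add_apply]; split_ifs <;> ring
        · show (∑ j, if sideP j then 0 else κ j * (z + z') j) =
              (∑ j, if sideP j then 0 else κ j * z j) + ∑ j, if sideP j then 0 else κ j * z' j
          rw [← Finset.sum_add_distrib]
          exact Finset.sum_congr rfl fun j _ => by rw [Pi.add_apply]; split_ifs <;> ring
      map_smul' := fun c z => by
        refine Prod.ext ?_ ?_
        · show (∑ j, if sideP j then κ j * (c • z) j else 0) =
              c • ∑ j, if sideP j then κ j * z j else 0
          rw [smul_eq_mul, Finset.mul_sum]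
          exact Finset.sum_congr rfl fun j _ => by
            rw [Pi.smul_apply, smul_eq_mul]; split_ifs <;> ring
        · show (∑ j, if sideP j then 0 else κ j * (c • z) j) =
              c • ∑ j, if sideP j then 0 else κ j * z j
          rw [smul_eq_mul, Finset.mul_sum]
          exact Finset.sum_congr rfl fun j _ => by
            rw [Pi.smul_apply, smul_eq_mul]; split_ifs <;> ring }
  have hΦ : ∀ z, Φ z = (∑ j, if sideP j then κ j * z j else 0,
      ∑ j, if sideP j then 0 else κ j * z j) := fun z => rfl
  have hrange : LinearMap.range Λ ≤ LinearMap.ker Φ := by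
    rintro _ ⟨w, rfl⟩
    rw [LinearMap.mem_ker, hΦ, Prod.mk_eq_zero]
    constructor
    · have e : (∑ j, if sideP j then κ j * Λ w j else 0) = ∑ j, κ j * Pt j w :=
        Finset.sum_congr rfl fun j _ => by
          by_cases hj : sideP j
          · rw [if_pos hj, hΛ]; simp only [Ψ, if_pos hj]
          · rw [if_neg hj, hP_of_notP j hj w w.2, mul_zero]
      rw [e]; exact relP w
    · have e : (∑ j, if sideP j then 0 else κ j * Λ w j) = ∑ j, κ j * Qt j w :=
        Finset.sum_congr rfl fun j _ => by
          by_cases hj : sideP j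
          · rw [if_pos hj, hQ_of_P j hj w w.2, mul_zero]
          · rw [if_neg hj, hΛ]; simp only [Ψ, if_neg hj]
      rw [e]; exact relQ w
  have hsurj : LinearMap.range Φ = ⊤ := by
    rw [eq_top_iff]
    rintro ⟨x, y⟩ -
    refine ⟨Pi.single jP (x / κ jP) + Pi.single jQ (y / κ jQ), ?_⟩
    rw [hΦ, Prod.mk.injEq]
    have hne : jP ≠ jQ := fun h => hjQ (h ▸ hjP)
    constructor
    · rw [Finset.sum_eq_single jP]
      · rw [if_pos hjP, Pi.add_apply, Pi.single_eq_same, Pi.single_eq_of_ne hne, add_zero]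
        have := hκ jP
        field_simp
      · intro j _ hj
        by_cases hs : sideP j
        · rw [if_pos hs, Pi.add_apply, Pi.single_eq_of_ne hj]
          have : j ≠ jQ := fun h => hjQ (h ▸ hs)
          rw [Pi.single_eq_of_ne this, add_zero, mul_zero]
        · rw [if_neg hs]
      · intro h; exact absurd (Finset.mem_univ jP) h
    · rw [Finset.sum_eq_single jQ]
      · rw [if_neg hjQ, Pi.add_apply, Pi.single_eq_same, Pi.single_eq_of_ne (Ne.symm hne), zero_add]
        have := hκ jQ
        field_simp
      · intro j _ hj
        by_cases hs : sideP j
        · rw [if_pos hs]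
        · rw [if_neg hs, Pi.add_apply, Pi.single_eq_of_ne hj, add_zero]
          have : j ≠ jP := fun h => hs (h ▸ hjP)
          rw [Pi.single_eq_of_ne this, mul_zero]
      · intro h; exact absurd (Finset.mem_univ jQ) h
  have hker : finrank K (LinearMap.ker Φ) = 3 := by
    have h := LinearMap.finrank_range_add_finrank_ker Φ
    rw [hsurj, finrank_top, finrank_prod, finrank_self, finrank_fintype_fun_eq_card,
      Fintype.card_option, Fintype.card_fin] at h
    omega
  have h1 : finrank K W = finrank K (LinearMap.range Λ) :=
    (LinearMap.finrank_range_of_inj hinj).symm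
  have h2 := Submodule.finrank_mono hrange
  omega

/-- **`≥ 4`-dimensional linear subspaces of the cone at `v` (non-zero coordinates) are
one-sided** (transport of `fst_or_snd_of_four_le` along `diag(v)`). [folklore] -/
theorem fst_or_snd_of_four_le_diag [CharZero K] (v : Fin 4 → K) (hv : ∀ i, v i ≠ 0)
    (W : Submodule K ((Fin 4 → K) × (Fin 4 → K)))
    (hW : ∀ w ∈ W, ∀ l : Fin 4, (Matrix.of ![v, Pi.single l 1, w.1, w.2]).permanent = 0)
    (h4 : 4 ≤ finrank K W) :
    (∀ w ∈ W, w.2 = 0) ∨ (∀ w ∈ W, w.1 = 0) := by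
  let D : (Fin 4 → K) ≃ₗ[K] (Fin 4 → K) :=
    { toFun := fun x i => x i / v i
      invFun := fun x i => v i * x i
      map_add' := fun x y => by funext i; simp only [Pi.add_apply]; ring
      map_smul' := fun c x => by
        funext i; simp only [Pi.smul_apply, smul_eq_mul, RingHom.id_apply]; ring
      left_inv := fun x => by funext i; have := hv i; simp only; field_simp
      right_inv := fun x => by funext i; have := hv i; simp only; field_simp }
  have hDinv : ∀ x i, v i * D x i = x i := fun x i => by
    have := hv i; show v i * (x i / v i) = x i; field_simp
  let DD := D.prodCongr D
  set W' : Submodule K ((Fin 4 → K) × (Fin 4 → K)) := W.map (DD : _ →ₗ[K] _) with hW'def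
  have hmem' : ∀ w ∈ W, ((D w.1, D w.2) : (Fin 4 → K) × (Fin 4 → K)) ∈ W' := by
    intro w hw
    rw [hW'def, Submodule.mem_map]
    exact ⟨w, hw, rfl⟩
  have hW' : ∀ w' ∈ W', ∀ l : Fin 4,
      (Matrix.of ![(fun _ => (1 : K)), Pi.single l 1, w'.1, w'.2]).permanent = 0 := by
    intro w' hw' l
    rw [hW'def, Submodule.mem_map] at hw'
    obtain ⟨w, hw, rfl⟩ := hw'
    have h := hW w hw l
    have hx : w.1 = fun i => v i * D w.1 i := by funext i; rw [hDinv]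
    have hx' : w.2 = fun i => v i * D w.2 i := by funext i; rw [hDinv]
    rw [hx, hx'] at h
    have hper := per_single_diag v (D w.1) (D w.2) l
    rw [h, mul_zero] at hper
    have hc : v 0 * v 1 * v 2 * v 3 ≠ 0 :=
      mul_ne_zero (mul_ne_zero (mul_ne_zero (hv 0) (hv 1)) (hv 2)) (hv 3)
    exact (mul_eq_zero.1 hper.symm).resolve_left hc
  have h4' : 4 ≤ finrank K W' := by
    rw [hW'def, LinearEquiv.finrank_map_eq]; exact h4
  rcases fst_or_snd_of_four_le W' hW' h4' with h | h
  · left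
    intro w hw
    have h' := h _ (hmem' w hw)
    funext i
    have := congr_fun h' i
    have hvi := hv i
    simp only [Pi.zero_apply] at this
    change w.2 i / v i = 0 at this
    rcases div_eq_zero_iff.1 this with h0 | h0
    · exact h0
    · exact absurd h0 hvi
  · right
    intro w hw
    have h' := h _ (hmem' w hw)
    funext i
    have := congr_fun h' i
    have hvi := hv i
    simp only [Pi.zero_apply] at this
    change w.1 i / v i = 0 at this
    rcases div_eq_zero_iff.1 this with h0 | h0
    · exact h0
    · exact absurd h0 hvi

end Summit.ValiantsHypothesis.ValiantsHypothesis.Theorems.SymPencilPerFourInnerRankConeFour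

end
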